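import Summits.NavierStokesRegularity.NavierStokesRegularity.Theorems.ExtremiserTransienceKStarAttainedVariation
import HarnessLib

/-!
# Route `ExtremiserTransience`, support item `KStarAttained` (stmt-NavierStokesRegularity-24370):
# KKT SIGN CONDITIONS FOR AN ATTAINER OF `κ⋆` (the Lagrange multiplier of `|v| ≤ M` is nonnegative)

`--supports stmt-NavierStokesRegularity-24370`. Author: prover seat `ns-et-p1` (g3).

Continuation of `…KStarAttainedVariation`. Let `(v, M, B)` be admissible with `‖v‖ ≤ M` and ATTAIN the sharp
constant: `|J| = κ⋆·M·‖ω‖₂·‖∇ω‖₂`, and let `ℓ(φ) := J·J₁(φ) − κ⋆²M²(W·a₁(φ) + Z·c₁(φ))` be the first variation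
(notation of `…KStarAttainedVariation`: `J₁, a₁, c₁` the linear coefficients of `J, Z = ‖ω‖₂², W = ‖∇ω‖₂²` along
`v + εφ`). For a smooth compactly supported divergence-free `φ` that points INTO the constraint everywhere,
`⟪v, φ⟫ ≤ 0`, one has `‖v + εφ‖² = ‖v‖² + 2ε⟪v,φ⟫ + ε²‖φ‖² ≤ M² + ε²‖φ‖∞²` for `ε ≥ 0`, so by universality of
`κ⋆` the polynomial `J(v+εφ)² − κ⋆²(M² + ε²Φ²)·Z(v+εφ)·W(v+εφ)` is `≤ 0` on `[0, ∞)` and `= 0` at `0`: its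
right derivative at `0` is `≤ 0` (one-sided Fermat, `linear_coeff_nonpos_of_sq_le`). Results:

* `KStar.firstVariation_nonpos_of_inner_nonpos` — `⟪v, φ⟫ ≤ 0` everywhere ⇒ `ℓ(φ) ≤ 0`;
* `KStar.firstVariation_nonneg_of_inner_nonneg` — `⟪v, φ⟫ ≥ 0` everywhere ⇒ `ℓ(φ) ≥ 0`;
* `KStar.firstVariation_eq_zero_of_inner_eq_zero` — **`⟪v, φ⟫ ≡ 0` ⇒ `ℓ(φ) = 0`**: the Euler–Lagrange equation
  holds against every perturbation pointwise orthogonal to `v`, in particular against the tangential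
  perturbations INSIDE the speed plateau `{‖v‖ = M}` of `…KStarAttainedContact`.

Read distributionally (`ℓ(φ) = ∫⟪g, φ⟫` with the smooth Euler–Lagrange field `g` of `…KStarAttainedDensity`), the
sign condition says `g ≡ λ·v (mod gradients)` with a NONNEGATIVE multiplier `λ` supported on the contact set —
the Karush–Kuhn–Tucker structure of the obstacle `|v| ≤ M`. WHAT THIS IS NOT: the item (attainment) is not
decided; nothing about Navier–Stokes solutions; NS regularity is NOT proved by anything here. [folklore]
-/

noncomputable section

open Set Filter Topology MeasureTheory
open scoped InnerProductSpace RealInnerProductSpace ENNReal NNReal ContDiff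
open Literature.Analysis.FluidPDE

namespace Summit.NavierStokesRegularity.NavierStokesRegularity.Theorems

-- the problem directory repeats the summit name (`NavierStokesRegularity/NavierStokesRegularity`)
set_option linter.dupNamespace false

namespace DepletionLadder.KStar

variable {v φ : EuclideanSpace ℝ (Fin 3) → EuclideanSpace ℝ (Fin 3)}

/-! ## One-sided Fermat for the polynomial comparison -/

/-- If `(J + εJ₁ + ε²J₂ + ε³J₃)² ≤ K²(M² + ε²P)(Z + 2εa₁ + ε²a₂)(W + 2εc₁ + ε²c₂)` for `0 ≤ ε < ε₁` with
equality at `ε = 0`, then the right derivative of the difference at `0` is `≤ 0`: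
`J·J₁ ≤ K²M²(W a₁ + Z c₁)` (the `ε²P` term does not contribute to first order). [folklore] -/
theorem linear_coeff_nonpos_of_sq_le {J J₁ J₂ J₃ K M P Z a₁ a₂ W c₁ c₂ ε₁ : ℝ} (hε₁ : 0 < ε₁)
    (hf0 : J ^ 2 = K ^ 2 * M ^ 2 * Z * W)
    (hle : ∀ ε, 0 ≤ ε → ε < ε₁ → (J + ε * J₁ + ε ^ 2 * J₂ + ε ^ 3 * J₃) ^ 2 ≤
        K ^ 2 * (M ^ 2 + ε ^ 2 * P) * (Z + 2 * ε * a₁ + ε ^ 2 * a₂) * (W + 2 * ε * c₁ + ε ^ 2 * c₂)) :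
    J * J₁ ≤ K ^ 2 * M ^ 2 * (W * a₁ + Z * c₁) := by
  set f : ℝ → ℝ := fun ε => (J + ε * J₁ + ε ^ 2 * J₂ + ε ^ 3 * J₃) ^ 2 -
    K ^ 2 * (M ^ 2 + ε ^ 2 * P) * (Z + 2 * ε * a₁ + ε ^ 2 * a₂) * (W + 2 * ε * c₁ + ε ^ 2 * c₂) with hf
  have hf00 : f 0 = 0 := by simp only [hf]; linear_combination hf0
  have hA : HasDerivAt (fun ε : ℝ => J + ε * J₁ + ε ^ 2 * J₂ + ε ^ 3 * J₃) J₁ 0 := by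
    have h := ((((hasDerivAt_id' (0 : ℝ)).mul_const J₁).const_add J).add
      ((hasDerivAt_pow 2 (0 : ℝ)).mul_const J₂)).add ((hasDerivAt_pow 3 (0 : ℝ)).mul_const J₃)
    exact h.congr_deriv (by simp)
  have hP : HasDerivAt (fun ε : ℝ => M ^ 2 + ε ^ 2 * P) 0 0 := by
    have h := ((hasDerivAt_pow 2 (0 : ℝ)).mul_const P).const_add (M ^ 2)
    exact h.congr_deriv (by simp)
  have hZ : HasDerivAt (fun ε : ℝ => Z + 2 * ε * a₁ + ε ^ 2 * a₂) (2 * a₁) 0 := by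
    have h := (((((hasDerivAt_id' (0 : ℝ)).const_mul 2).mul_const a₁).const_add Z)).add
      ((hasDerivAt_pow 2 (0 : ℝ)).mul_const a₂)
    exact h.congr_deriv (by simp)
  have hW : HasDerivAt (fun ε : ℝ => W + 2 * ε * c₁ + ε ^ 2 * c₂) (2 * c₁) 0 := by
    have h := (((((hasDerivAt_id' (0 : ℝ)).const_mul 2).mul_const c₁).const_add W)).add
      ((hasDerivAt_pow 2 (0 : ℝ)).mul_const c₂)
    exact h.congr_deriv (by simp)
  have hF : HasDerivAt f (2 * J * J₁ - K ^ 2 * (M ^ 2 * (2 * a₁) * W + M ^ 2 * Z * (2 * c₁))) 0 := by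
    have h := (hA.pow 2).sub ((((hP.const_mul (K ^ 2)).mul hZ).mul hW))
    exact h.congr_deriv (by simp; ring)
  -- one-sided Fermat: if the derivative were positive, `f > 0` just to the right of `0`
  by_contra hcon
  have hD : 0 < 2 * J * J₁ - K ^ 2 * (M ^ 2 * (2 * a₁) * W + M ^ 2 * Z * (2 * c₁)) := by linarith
  have hslope : Tendsto (slope f 0) (𝓝[>] (0 : ℝ))
      (𝓝 (2 * J * J₁ - K ^ 2 * (M ^ 2 * (2 * a₁) * W + M ^ 2 * Z * (2 * c₁)))) :=
    (hasDerivAt_iff_tendsto_slope.1 hF).mono_left (nhdsWithin_mono _ fun x hx => ne_of_gt hx)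
  have hev₁ : ∀ᶠ ε in 𝓝[>] (0 : ℝ), 0 < slope f 0 ε := hslope.eventually_const_lt hD
  have hev₂ : ∀ᶠ ε in 𝓝[>] (0 : ℝ), ε ∈ Ioo (0 : ℝ) ε₁ := Ioo_mem_nhdsGT hε₁
  obtain ⟨ε, hε, hεI⟩ := (hev₁.and hev₂).exists
  have hfε : f ε ≤ 0 := sub_nonpos.2 (hle ε hεI.1.le hεI.2)
  rw [slope_def_field, hf00, sub_zero, sub_zero] at hε
  have : 0 < f ε := by
    have := mul_pos hε hεI.1
    rwa [div_mul_cancel₀ _ hεI.1.ne'] at this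
  linarith

/-! ## The sign conditions -/

/-- **KKT sign condition (inward perturbations).** If `(v, M, B)` is admissible with `‖v‖ ≤ M`, attains `κ⋆`,
and `φ ∈ C^∞_c` is divergence free with `⟪v, φ⟫ ≤ 0` everywhere, then `ℓ(φ) ≤ 0`:
`J·J₁(φ) ≤ κ⋆²·M²·(W·a₁(φ) + Z·c₁(φ))`. [folklore] -/
theorem firstVariation_nonpos_of_inner_nonpos (hv : ContDiff ℝ ∞ v) (hdiv : VectorCalculus.IsDivFree v)
    {M B : ℝ} (hM : ∀ x, ‖v x‖ ≤ M) (hB : ∀ x, ‖fderiv ℝ v x‖ ≤ B)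
    (h0 : ∫⁻ x, ‖iteratedFDeriv ℝ 0 v x‖ₑ ^ 2 < ⊤)
    (h1 : ∫⁻ x, ‖iteratedFDeriv ℝ 1 v x‖ₑ ^ 2 < ⊤) (h2 : ∫⁻ x, ‖iteratedFDeriv ℝ 2 v x‖ₑ ^ 2 < ⊤)
    (hatt : |∫ x, ⟪curl v x, fderiv ℝ v x (curl v x)⟫| =
      sInf {κ : ℝ | (∀ (v : EuclideanSpace ℝ (Fin 3) → EuclideanSpace ℝ (Fin 3)) (M B : ℝ), ContDiff ℝ (⊤ : ℕ∞) v → Literature.Analysis.FluidPDE.VectorCalculus.IsDivFree v → (∀ x, ‖v x‖ ≤ M) → (∀ x, ‖fderiv ℝ v x‖ ≤ B) → (∫⁻ x, ‖iteratedFDeriv ℝ 0 v x‖ₑ ^ 2 < ⊤) → (∫⁻ x, ‖iteratedFDeriv ℝ 1 v x‖ₑ ^ 2 < ⊤) → (∫⁻ x, ‖iteratedFDeriv ℝ 2 v x‖ₑ ^ 2 < ⊤) → |∫ x, ⟪Literature.Analysis.FluidPDE.curl v x, fderiv ℝ v x (Literature.Analysis.FluidPDE.curl v x)⟫_ℝ|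 ≤ κ * M * Real.sqrt (∫ x, ‖Literature.Analysis.FluidPDE.curl v x‖ ^ 2) * Real.sqrt (∫ x, Literature.Analysis.FluidPDE.frobeniusNormSq (fderiv ℝ (Literature.Analysis.FluidPDE.curl v) x)))} * M * Real.sqrt (∫ x, ‖curl v x‖ ^ 2) *
        Real.sqrt (∫ x, frobeniusNormSq (fderiv ℝ (curl v) x)))
    (hφ : ContDiff ℝ ∞ φ) (hφc : HasCompactSupport φ) (hφdiv : VectorCalculus.IsDivFree φ)
    (hsign : ∀ x, ⟪v x, φ x⟫ ≤ 0) :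
    (∫ x, ⟪curl v x, fderiv ℝ v x (curl v x)⟫) * (∫ x, (⟪curl φ x, fderiv ℝ v x (curl v x)⟫ + ⟪curl v x, fderiv ℝ φ x (curl v x)⟫ +
          ⟪curl v x, fderiv ℝ v x (curl φ x)⟫)) ≤
      sInf {κ : ℝ | (∀ (v : EuclideanSpace ℝ (Fin 3) → EuclideanSpace ℝ (Fin 3)) (M B : ℝ), ContDiff ℝ (⊤ : ℕ∞) v → Literature.Analysis.FluidPDE.VectorCalculus.IsDivFree v → (∀ x, ‖v x‖ ≤ M) → (∀ x, ‖fderiv ℝ v x‖ ≤ B) → (∫⁻ x, ‖iteratedFDeriv ℝ 0 v x‖ₑ ^ 2 < ⊤) → (∫⁻ x, ‖iteratedFDeriv ℝ 1 v x‖ₑ ^ 2 < ⊤) → (∫⁻ x, ‖iteratedFDeriv ℝ 2 v x‖ₑ ^ 2 < ⊤) → |∫ x, ⟪Literature.Analysis.FluidPDE.curl v x, fderiv ℝ v x (Literature.Analysis.FluidPDE.curl v x)⟫_ℝ| ≤ κ * M * Real.sqrt (∫ x, ‖Literature.Analysis.FluidPDE.curl v x‖ ^ 2) * Real.sqrt (∫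 x, Literature.Analysis.FluidPDE.frobeniusNormSq (fderiv ℝ (Literature.Analysis.FluidPDE.curl v) x)))} ^ 2 * M ^ 2 * ((∫ x, frobeniusNormSq (fderiv ℝ (curl v) x)) * (∫ x, ⟪curl v x, curl φ x⟫) + (∫ x, ‖curl v x‖ ^ 2) * (∫ x, ∑ i, ⟪fderiv ℝ (curl v) x (EuclideanSpace.basisFun (Fin 3) ℝ i),
          fderiv ℝ (curl φ) x (EuclideanSpace.basisFun (Fin 3) ℝ i)⟫)) := by
  have huniv := DepletionLadder.sharpDepletion_is_universal
  set K : ℝ := sInf {κ : ℝ | (∀ (v : EuclideanSpace ℝ (Fin 3) → EuclideanSpace ℝ (Fin 3)) (M B : ℝ), ContDiff ℝ (⊤ : ℕ∞) v → Literature.Analysis.FluidPDE.VectorCalculus.IsDivFree v → (∀ x, ‖v x‖ ≤ M) → (∀ x, ‖fderiv ℝ v x‖ ≤ B) → (∫⁻ x, ‖iteratedFDeriv ℝ 0 v x‖ₑ ^ 2 < ⊤) → (∫⁻ x, ‖iteratedFDeriv ℝ 1 v x‖ₑ ^ 2 < ⊤) → (∫⁻ x, ‖iteratedFDeriv ℝ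 2 v x‖ₑ ^ 2 < ⊤) → |∫ x, ⟪Literature.Analysis.FluidPDE.curl v x, fderiv ℝ v x (Literature.Analysis.FluidPDE.curl v x)⟫_ℝ| ≤ κ * M * Real.sqrt (∫ x, ‖Literature.Analysis.FluidPDE.curl v x‖ ^ 2) * Real.sqrt (∫ x, Literature.Analysis.FluidPDE.frobeniusNormSq (fderiv ℝ (Literature.Analysis.FluidPDE.curl v) x)))} with hK
  have hM0 : 0 ≤ M := (norm_nonneg _).trans (hM 0)
  have hZ0 : 0 ≤ (∫ x, ‖curl v x‖ ^ 2) := integral_nonneg fun x => sq_nonneg _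
  have hW0 : 0 ≤ (∫ x, frobeniusNormSq (fderiv ℝ (curl v) x)) := integral_nonneg fun x => frobeniusNormSq_nonneg _
  obtain ⟨C, hC⟩ := hφ.continuous.bounded_above_of_compact_support hφc
  -- the norm bound `‖v + εφ‖ ≤ √(M² + ε²C²)` for `ε ≥ 0`
  have hbound : ∀ ε : ℝ, 0 ≤ ε → ∀ x, ‖v x + ε • φ x‖ ≤ Real.sqrt (M ^ 2 + ε ^ 2 * C ^ 2) := by
    intro ε hε x
    refine Real.le_sqrt_of_sq_le ?_
    rw [norm_add_smul_sq_expand]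
    have h1' : ‖v x‖ ^ 2 ≤ M ^ 2 := pow_le_pow_left₀ (norm_nonneg _) (hM x) 2
    have h2' : ‖φ x‖ ^ 2 ≤ C ^ 2 := pow_le_pow_left₀ (norm_nonneg _) (hC x) 2
    have h3' : 2 * ε * ⟪v x, φ x⟫ ≤ 0 := mul_nonpos_of_nonneg_of_nonpos (by positivity) (hsign x)
    nlinarith [sq_nonneg ε]
  refine linear_coeff_nonpos_of_sq_le one_pos (P := C ^ 2)
    (J₂ := ∫ x, (⟪curl φ x, fderiv ℝ φ x (curl v x)⟫ + ⟪curl φ x, fderiv ℝ v x (curl φ x)⟫ +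
      ⟪curl v x, fderiv ℝ φ x (curl φ x)⟫))
    (J₃ := ∫ x, ⟪curl φ x, fderiv ℝ φ x (curl φ x)⟫) (a₂ := ∫ x, ‖curl φ x‖ ^ 2)
    (c₂ := ∫ x, frobeniusNormSq (fderiv ℝ (curl φ) x)) ?_ fun ε hε _ => ?_
  · calc (∫ x, ⟪curl v x, fderiv ℝ v x (curl v x)⟫) ^ 2 = |∫ x, ⟪curl v x, fderiv ℝ v x (curl v x)⟫| ^ 2 := (sq_abs _).symm
      _ = (K * M * Real.sqrt (∫ x, ‖curl v x‖ ^ 2) * Real.sqrt (∫ x, frobeniusNormSq (fderiv ℝ (curl v) x))) ^ 2 := by rw [hatt]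
      _ = K ^ 2 * M ^ 2 * (∫ x, ‖curl v x‖ ^ 2) * (∫ x, frobeniusNormSq (fderiv ℝ (curl v) x)) := by
          rw [mul_pow, mul_pow, mul_pow, Real.sq_sqrt hZ0, Real.sq_sqrt hW0]
  · obtain ⟨hcd, hdv, ⟨B', hB'⟩, h0', h1', h2'⟩ := admissible_add_smul hv hdiv hB h0 h1 h2 hφ hφc hφdiv ε
    have hu := huniv _ (Real.sqrt (M ^ 2 + ε ^ 2 * C ^ 2)) B' hcd hdv (hbound ε hε) hB' h0' h1' h2'
    have hZε : 0 ≤ ∫ x, ‖curl (fun y => v y + ε • φ y) x‖ ^ 2 := integral_nonneg fun x => sq_nonneg _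
    have hWε : 0 ≤ ∫ x, frobeniusNormSq (fderiv ℝ (curl (fun y => v y + ε • φ y)) x) :=
      integral_nonneg fun x => frobeniusNormSq_nonneg _
    have hR0 : 0 ≤ M ^ 2 + ε ^ 2 * C ^ 2 := by positivity
    have hsq : (∫ x, ⟪curl (fun y => v y + ε • φ y) x,
        fderiv ℝ (fun y => v y + ε • φ y) x (curl (fun y => v y + ε • φ y) x)⟫) ^ 2 ≤
        (K * Real.sqrt (M ^ 2 + ε ^ 2 * C ^ 2) * Real.sqrt (∫ x, ‖curl (fun y => v y + ε • φ y) x‖ ^ 2) *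
          Real.sqrt (∫ x, frobeniusNormSq (fderiv ℝ (curl (fun y => v y + ε • φ y)) x))) ^ 2 := by
      rw [← sq_abs (∫ x, ⟪curl (fun y => v y + ε • φ y) x,
        fderiv ℝ (fun y => v y + ε • φ y) x (curl (fun y => v y + ε • φ y) x)⟫)]
      exact pow_le_pow_left₀ (abs_nonneg _) hu 2
    rw [mul_pow, mul_pow, mul_pow, Real.sq_sqrt hR0, Real.sq_sqrt hZε, Real.sq_sqrt hWε,
      integral_stretching_add_smul hv hB h1 hφ hφc ε, integral_normSq_curl_add_smul hv h1 hφ hφc ε,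
      integral_frobeniusNormSq_add_smul hv h2 hφ hφc ε] at hsq
    exact hsq

/-- **KKT sign condition (outward perturbations).** Same setting with `⟪v, φ⟫ ≥ 0` everywhere: `ℓ(φ) ≥ 0`,
i.e. `κ⋆²·M²·(W·a₁(φ) + Z·c₁(φ)) ≤ J·J₁(φ)` (apply the inward case to `−φ`; all three coefficients are odd
in `φ`). [folklore] -/
theorem firstVariation_nonneg_of_inner_nonneg (hv : ContDiff ℝ ∞ v) (hdiv : VectorCalculus.IsDivFree v)
    {M B : ℝ} (hM : ∀ x, ‖v x‖ ≤ M) (hB : ∀ x, ‖fderiv ℝ v x‖ ≤ B)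
    (h0 : ∫⁻ x, ‖iteratedFDeriv ℝ 0 v x‖ₑ ^ 2 < ⊤)
    (h1 : ∫⁻ x, ‖iteratedFDeriv ℝ 1 v x‖ₑ ^ 2 < ⊤) (h2 : ∫⁻ x, ‖iteratedFDeriv ℝ 2 v x‖ₑ ^ 2 < ⊤)
    (hatt : |∫ x, ⟪curl v x, fderiv ℝ v x (curl v x)⟫| =
      sInf {κ : ℝ | (∀ (v : EuclideanSpace ℝ (Fin 3) → EuclideanSpace ℝ (Fin 3)) (M B : ℝ), ContDiff ℝ (⊤ : ℕ∞) v → Literature.Analysis.FluidPDE.VectorCalculus.IsDivFree v → (∀ x, ‖v x‖ ≤ M) → (∀ x, ‖fderiv ℝ v x‖ ≤ B) → (∫⁻ x, ‖iteratedFDeriv ℝ 0 v x‖ₑ ^ 2 < ⊤) → (∫⁻ x, ‖iteratedFDeriv ℝ 1 v x‖ₑ ^ 2 < ⊤) → (∫⁻ x, ‖iteratedFDeriv ℝ 2 v x‖ₑ ^ 2 < ⊤) → |∫ x, ⟪Literature.Analysis.FluidPDE.curl v x, fderiv ℝ v x (Literature.Analysis.FluidPDE.curl v x)⟫_ℝ|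 ≤ κ * M * Real.sqrt (∫ x, ‖Literature.Analysis.FluidPDE.curl v x‖ ^ 2) * Real.sqrt (∫ x, Literature.Analysis.FluidPDE.frobeniusNormSq (fderiv ℝ (Literature.Analysis.FluidPDE.curl v) x)))} * M * Real.sqrt (∫ x, ‖curl v x‖ ^ 2) *
        Real.sqrt (∫ x, frobeniusNormSq (fderiv ℝ (curl v) x)))
    (hφ : ContDiff ℝ ∞ φ) (hφc : HasCompactSupport φ) (hφdiv : VectorCalculus.IsDivFree φ)
    (hsign : ∀ x, 0 ≤ ⟪v x, φ x⟫) :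
    sInf {κ : ℝ | (∀ (v : EuclideanSpace ℝ (Fin 3) → EuclideanSpace ℝ (Fin 3)) (M B : ℝ), ContDiff ℝ (⊤ : ℕ∞) v → Literature.Analysis.FluidPDE.VectorCalculus.IsDivFree v → (∀ x, ‖v x‖ ≤ M) → (∀ x, ‖fderiv ℝ v x‖ ≤ B) → (∫⁻ x, ‖iteratedFDeriv ℝ 0 v x‖ₑ ^ 2 < ⊤) → (∫⁻ x, ‖iteratedFDeriv ℝ 1 v x‖ₑ ^ 2 < ⊤) → (∫⁻ x, ‖iteratedFDeriv ℝ 2 v x‖ₑ ^ 2 < ⊤) → |∫ x, ⟪Literature.Analysis.FluidPDE.curl v x, fderiv ℝ v x (Literature.Analysis.FluidPDE.curl v x)⟫_ℝ| ≤ κ * M * Real.sqrt (∫ x, ‖Literature.Analysis.FluidPDE.curl v x‖ ^ 2) * Real.sqrt (∫ x, Literature.Analysis.FluidPDE.frobeniusNormSq (fderiv ℝ (Literature.Analysis.FluidPDE.curl v) x)))} ^ 2 * M ^ 2 * ((∫ x, frobeniusNormSq (fderiv ℝ (curl v) x)) * (∫ x, ⟪curl v x, curl φ x⟫) + (∫ x,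 ‖curl v x‖ ^ 2) * (∫ x, ∑ i, ⟪fderiv ℝ (curl v) x (EuclideanSpace.basisFun (Fin 3) ℝ i),
          fderiv ℝ (curl φ) x (EuclideanSpace.basisFun (Fin 3) ℝ i)⟫)) ≤
      (∫ x, ⟪curl v x, fderiv ℝ v x (curl v x)⟫) * (∫ x, (⟪curl φ x, fderiv ℝ v x (curl v x)⟫ + ⟪curl v x, fderiv ℝ φ x (curl v x)⟫ +
          ⟪curl v x, fderiv ℝ v x (curl φ x)⟫)) := by
  -- apply the inward case to `ψ = −φ`
  have hψ : ContDiff ℝ ∞ fun y => -φ y := hφ.neg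
  have hψc : HasCompactSupport fun y => -φ y := hφc.comp_left (g := Neg.neg) neg_zero
  have hφd : Differentiable ℝ φ := hφ.differentiable (by simp)
  have hψdiv : VectorCalculus.IsDivFree fun y => -φ y := by
    intro x
    have h := divergence_add_smul (v := fun _ => (0 : EuclideanSpace ℝ (Fin 3))) (φ := φ)
      (differentiable_const _) hφd (-1) x
    simp only [neg_smul, one_smul, zero_add] at h
    rw [h, hφdiv x, mul_zero, add_zero]
    unfold VectorCalculus.divergence
    simp
  have hψsign : ∀ x, ⟪v x, -φ x⟫ ≤ 0 := fun x => by rw [inner_neg_right]; linarith [hsign x]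
  have h := firstVariation_nonpos_of_inner_nonpos hv hdiv hM hB h0 h1 h2 hatt hψ hψc hψdiv hψsign
  -- the coefficients are odd in `φ`
  have hcurl : ∀ x, curl (fun y => -φ y) x = -curl φ x := fun x => curl_neg φ x
  have hD : ∀ x, fderiv ℝ (fun y => -φ y) x = -fderiv ℝ φ x := fun x => fderiv_fun_neg
  have hcψ : (curl fun y => -φ y) = fun x => -curl φ x := funext hcurl
  have hDc : ∀ x, fderiv ℝ (curl fun y => -φ y) x = -fderiv ℝ (curl φ) x := fun x => by
    rw [hcψ]; exact fderiv_fun_neg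
  have hJ1 : (∫ x, (⟪curl (fun y => -φ y) x, fderiv ℝ v x (curl v x)⟫ + ⟪curl v x, fderiv ℝ (fun y => -φ y) x (curl v x)⟫ +
          ⟪curl v x, fderiv ℝ v x (curl (fun y => -φ y) x)⟫)) =
      -(∫ x, (⟪curl φ x, fderiv ℝ v x (curl v x)⟫ + ⟪curl v x, fderiv ℝ φ x (curl v x)⟫ +
          ⟪curl v x, fderiv ℝ v x (curl φ x)⟫)) := by
    rw [← integral_neg]
    refine integral_congr_ae (Eventually.of_forall fun x => ?_)
    simp only [hcurl, hD, inner_neg_left, inner_neg_right, map_neg, FunLike.coe_neg, Pi.neg_apply]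
    ring
  have ha1 : (∫ x, ⟪curl v x, curl (fun y => -φ y) x⟫) = -(∫ x, ⟪curl v x, curl φ x⟫) := by
    rw [← integral_neg]
    exact integral_congr_ae (Eventually.of_forall fun x => by simp only [hcurl, inner_neg_right])
  have hc1 : (∫ x, ∑ i, ⟪fderiv ℝ (curl v) x (EuclideanSpace.basisFun (Fin 3) ℝ i),
          fderiv ℝ (curl (fun y => -φ y)) x (EuclideanSpace.basisFun (Fin 3) ℝ i)⟫) =
      -(∫ x, ∑ i, ⟪fderiv ℝ (curl v) x (EuclideanSpace.basisFun (Fin 3) ℝ i),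
          fderiv ℝ (curl φ) x (EuclideanSpace.basisFun (Fin 3) ℝ i)⟫) := by
    rw [← integral_neg]
    refine integral_congr_ae (Eventually.of_forall fun x => ?_)
    simp only [hDc, FunLike.coe_neg, Pi.neg_apply, inner_neg_right, Finset.sum_neg_distrib]
  rw [hJ1, ha1, hc1] at h
  linarith

/-- **The Euler–Lagrange equation against perturbations orthogonal to `v`.** Same setting with `⟪v, φ⟫ ≡ 0`:
`ℓ(φ) = 0`, i.e. `J·J₁(φ) = κ⋆²·M²·(W·a₁(φ) + Z·c₁(φ))` — in particular for tangential perturbations inside the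
speed plateau `{‖v‖ = M}` of an attainer. [folklore] -/
theorem firstVariation_eq_zero_of_inner_eq_zero (hv : ContDiff ℝ ∞ v) (hdiv : VectorCalculus.IsDivFree v)
    {M B : ℝ} (hM : ∀ x, ‖v x‖ ≤ M) (hB : ∀ x, ‖fderiv ℝ v x‖ ≤ B)
    (h0 : ∫⁻ x, ‖iteratedFDeriv ℝ 0 v x‖ₑ ^ 2 < ⊤)
    (h1 : ∫⁻ x, ‖iteratedFDeriv ℝ 1 v x‖ₑ ^ 2 < ⊤) (h2 : ∫⁻ x, ‖iteratedFDeriv ℝ 2 v x‖ₑ ^ 2 < ⊤)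
    (hatt : |∫ x, ⟪curl v x, fderiv ℝ v x (curl v x)⟫| =
      sInf {κ : ℝ | (∀ (v : EuclideanSpace ℝ (Fin 3) → EuclideanSpace ℝ (Fin 3)) (M B : ℝ), ContDiff ℝ (⊤ : ℕ∞) v → Literature.Analysis.FluidPDE.VectorCalculus.IsDivFree v → (∀ x, ‖v x‖ ≤ M) → (∀ x, ‖fderiv ℝ v x‖ ≤ B) → (∫⁻ x, ‖iteratedFDeriv ℝ 0 v x‖ₑ ^ 2 < ⊤) → (∫⁻ x, ‖iteratedFDeriv ℝ 1 v x‖ₑ ^ 2 < ⊤) → (∫⁻ x, ‖iteratedFDeriv ℝ 2 v x‖ₑ ^ 2 < ⊤) → |∫ x, ⟪Literature.Analysis.FluidPDE.curl v x, fderiv ℝ v x (Literature.Analysis.FluidPDE.curl v x)⟫_ℝ| ≤ κ * M * Real.sqrt (∫ x, ‖Literature.Analysis.FluidPDE.curl v x‖ ^ 2) * Real.sqrt (∫ x, Literature.Analysis.FluidPDE.frobeniusNormSq (fderiv ℝ (Literature.Analysis.FluidPDE.curl v) x)))} * M * Real.sqrt (∫ x, ‖curl v x‖ ^ 2) *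
        Real.sqrt (∫ x, frobeniusNormSq (fderiv ℝ (curl v) x)))
    (hφ : ContDiff ℝ ∞ φ) (hφc : HasCompactSupport φ) (hφdiv : VectorCalculus.IsDivFree φ)
    (horth : ∀ x, ⟪v x, φ x⟫ = 0) :
    (∫ x, ⟪curl v x, fderiv ℝ v x (curl v x)⟫) * (∫ x, (⟪curl φ x, fderiv ℝ v x (curl v x)⟫ + ⟪curl v x, fderiv ℝ φ x (curl v x)⟫ +
          ⟪curl v x, fderiv ℝ v x (curl φ x)⟫)) =
      sInf {κ : ℝ | (∀ (v : EuclideanSpace ℝ (Fin 3) → EuclideanSpace ℝ (Fin 3)) (M B : ℝ), ContDiff ℝ (⊤ : ℕ∞) v → Literature.Analysis.FluidPDE.VectorCalculus.IsDivFree v → (∀ x, ‖v x‖ ≤ M) → (∀ x, ‖fderiv ℝ v x‖ ≤ B) → (∫⁻ x, ‖iteratedFDeriv ℝ 0 v x‖ₑ ^ 2 < ⊤) → (∫⁻ x, ‖iteratedFDeriv ℝ 1 v x‖ₑ ^ 2 < ⊤) → (∫⁻ x, ‖iteratedFDeriv ℝ 2 v x‖ₑ ^ 2 < ⊤) → |∫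 x, ⟪Literature.Analysis.FluidPDE.curl v x, fderiv ℝ v x (Literature.Analysis.FluidPDE.curl v x)⟫_ℝ| ≤ κ * M * Real.sqrt (∫ x, ‖Literature.Analysis.FluidPDE.curl v x‖ ^ 2) * Real.sqrt (∫ x, Literature.Analysis.FluidPDE.frobeniusNormSq (fderiv ℝ (Literature.Analysis.FluidPDE.curl v) x)))} ^ 2 * M ^ 2 * ((∫ x, frobeniusNormSq (fderiv ℝ (curl v) x)) * (∫ x, ⟪curl v x, curl φ x⟫) + (∫ x, ‖curl v x‖ ^ 2) * (∫ x, ∑ i, ⟪fderiv ℝ (curl v) x (EuclideanSpace.basisFun (Fin 3) ℝ i),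
          fderiv ℝ (curl φ) x (EuclideanSpace.basisFun (Fin 3) ℝ i)⟫)) :=
  le_antisymm
    (firstVariation_nonpos_of_inner_nonpos hv hdiv hM hB h0 h1 h2 hatt hφ hφc hφdiv fun x => (horth x).le)
    (firstVariation_nonneg_of_inner_nonneg hv hdiv hM hB h0 h1 h2 hatt hφ hφc hφdiv fun x => (horth x).ge)

end DepletionLadder.KStar

end Summit.NavierStokesRegularity.NavierStokesRegularity.Theorems

end
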